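import Summits.Ventures.LatticeQCDFlow.Scoring.ChainTauIntVarianceEstimator
import Summits.Ventures.LatticeQCDFlow.Scoring.ChainLagProductGaussianLimit

/-!
# THE STUDENTISED `τ̂_W` CLT ON MARKOV-CHAIN DATA: with the data-driven variance estimate `σ̂²_N` of
# `Scoring/ChainTauIntVarianceEstimator`, `√N (τ̂_W − τ_W) / σ̂_N ⇒ N(0, 1)` from EVERY initial law,
# and the interval `τ̂_W ± z σ̂_N/√N` has asymptotically EXACT coverage `N(0,1)([−z, z])`

HONEST FRAMING: exact (Metropolis-corrected) sampling algorithms for lattice gauge theory;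
figures of merit are autocorrelation/cost numbers at stated couplings and volumes; no
continuum-physics claim.

Venture `LatticeQCDFlow` (cell pub-lqcd), sub-topic `Scoring`; FANOUT row 16 (`su2-base`), GEN-10.
NEW WORK of the cell, not a published result; no definition is introduced; nothing is cited as a fact
(Slutsky's lemma and the portmanteau theorem from Mathlib; studentised confidence intervals for
functions of sample autocovariances of a time series — Priestley 1981 §5.3, Anderson 1971 §8.4 — NAMED
ONLY).  CLOSES THE LOOP of the law-of-the-error packet for chain data: GEN-9's fixed-window law
(`Scoring/ChainLagProductGaussianLimit.tendstoInDistribution_chain_tauIntWindow_multivariateGaussian`: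
`√N (τ̂_W − τ_W) ⇒ ⟪ℓ, Z⟫`, `Z ∼ N(0, Σ)`, law `N(0, σ²_ℓ)`, `σ²_ℓ = Σ_s Σ_t ℓ_s ℓ_t Σ(s,t)`) listed
'studentisation / printed-bar coverage on chain data (needs a consistent estimator of σ²_ℓ along the
chain)' as NOT CLAIMED; GEN-10's `Scoring/ChainTauIntVarianceEstimator` supplies that estimator
(`σ̂²_N → σ²_ℓ` in probability, truncations `K_N → ∞`, `K_N³/N → 0`); THIS FILE is the Slutsky step:
for every bounded observable with `C(0) ≠ 0` and `σ²_ℓ > 0`, along every chain with a Doeblin power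
and from EVERY initial law, `√N (τ̂_W − τ_W) · (√σ̂²_N)⁻¹ ⇒ N(0, 1)` and
`P_{μ₀}{|√N (τ̂_W − τ_W) (√σ̂²_N)⁻¹| ≤ z} → N(0,1)([−z, z])` — an HONEST error bar for the windowed
`τ_int` estimate on chain data, with no Gaussian-process, linear-process or Madras–Sokal-formula
assumption (contrast GEN-7/8's printed-bar coverage `→ N(0, R/((4W+2) τ_W²))([−z,z])`, nominal only when
`R = (4W+2) τ_W²`).

## Content (`κ` Markov, `π` invariant, `(nHit κ m)(z, ·) ≥ ε ν` for all `z`, `ε ≠ 0`, `0 < m`;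
## `|f| ≤ C` measurable, `f̄ = f − ∫ f dπ`, `C(t) = autocov κ π f̄ t`, `C(0) ≠ 0`; `Γ̂_N = acovHat (f̄ ∘ X) N`;
## `τ̂_W = tauIntWindow (Γ̂_N/Γ̂_N(0)) W`, `τ_W = tauIntWindow (C/C(0)) W`; `ℓ̂_N`, `ℓ`, `σ̂²_N`, `σ²_ℓ` as in
## `Scoring/ChainTauIntVarianceEstimator`; `K_N → ∞`, `K_N³/N → 0`; `μ₀` ANY initial law)

* `measurable_chain_tauIntVarHat` — `σ̂²_N` is a measurable function of the path;
  **`chain_invSqrt_tauIntVarHat_tendstoInMeasure_of_nHit`** — `(√σ̂²_N)⁻¹ → (√σ²_ℓ)⁻¹` in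
  `P_{μ₀}`-measure (`σ²_ℓ > 0`).
* **`tendstoInDistribution_chain_studentized_tauIntWindow_of_nHit`** — THE STUDENTISED CLT:
  `TendstoInDistribution (N ↦ √N (τ̂_W − τ_W) · (√σ̂²_N)⁻¹) atTop id P_{μ₀} (gaussianReal 0 1)`.
* **`tendsto_measure_chain_studentized_tauIntWindow_le_of_nHit`** — EXACT ASYMPTOTIC COVERAGE
  (`z > 0`): `P_{μ₀}{|√N (τ̂_W − τ_W) (√σ̂²_N)⁻¹| ≤ z} → gaussianReal 0 1 (Icc (−z) z)`;
  `…_of_minorised` — the one-step certificate shape `κ(z, ·) ≥ ε ν`.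

NOT CLAIMED: scorer A's sample-mean-centred `1/(N−t)` statistic in place of the known-mean `τ̂_W` (its
CLT is GEN-9's `ChainScorerTauIntCLT`; the same Slutsky step applies verbatim once the estimator is fed
the centred series — the `O_P(K_N/√N)` perturbation is not typed); the data-chosen window; `σ²_ℓ > 0`
for a given `f`; finite-`N` coverage or rates; unbounded `f`; any number about row 16's chains.
-/

noncomputable section

open MeasureTheory ProbabilityTheory Filter Finset Preorder WithLp Set
open scoped ENNReal NNReal Topology RealInnerProductSpace
open Summit.Ventures.LatticeQCDFlow.Exactness Summit.Ventures.LatticeQCDFlow.Exactness.GeneralNCMC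

namespace Summit.Ventures.LatticeQCDFlow.Scoring

variable {S : Type*} [MeasurableSpace S]

section Chain

variable (κ : Kernel S S) [IsMarkovKernel κ] (W : ℕ) {π : Measure S} [IsProbabilityMeasure π]
  {ν : Measure S} [IsProbabilityMeasure ν] {ε : ℝ≥0∞} {m : ℕ}

/-- `σ̂²_N` is a measurable function of the path. -/
theorem measurable_chain_tauIntVarHat {f : S → ℝ} (hf : Measurable f) (c : ℝ) (N K : ℕ) :
    Measurable fun x : ℕ → S => ∑ s : Fin (W + 1), ∑ t : Fin (W + 1),
        tauHatGrad W (toLp 2 fun u : Fin (W + 1) =>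
            acovHat (fun (i : ℕ) (x : ℕ → S) => f (x i) - c) N u x) s
          * tauHatGrad W (toLp 2 fun u : Fin (W + 1) =>
            acovHat (fun (i : ℕ) (x : ℕ → S) => f (x i) - c) N u x) t
          * gammaCross (fun i => (f (x i) - c) * (f (x (i + s)) - c))
              (fun i => (f (x i) - c) * (f (x (i + t)) - c)) N K := by
  have hXm : ∀ i : ℕ, Measurable fun x : ℕ → S => f (x i) - c := fun i =>
    (hf.comp (measurable_pi_apply i)).sub measurable_const
  have hG : ∀ s t : Fin (W + 1), Measurable fun x : ℕ → S =>
      gammaCross (fun i => (f (x i) - c) * (f (x (i + s)) - c))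
        (fun i => (f (x i) - c) * (f (x (i + t)) - c)) N K := fun s t =>
    measurable_gammaCross (u := fun (i : ℕ) (x : ℕ → S) => (f (x i) - c) * (f (x (i + s)) - c))
      (v := fun (i : ℕ) (x : ℕ → S) => (f (x i) - c) * (f (x (i + t)) - c))
      (fun i => (hXm i).mul (hXm (i + s))) (fun i => (hXm i).mul (hXm (i + t))) N K
  have hL : ∀ s : Fin (W + 1), Measurable fun x : ℕ → S =>
      tauHatGrad W (toLp 2 fun u : Fin (W + 1) =>
        acovHat (fun (i : ℕ) (x : ℕ → S) => f (x i) - c) N u x) s := fun s =>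
    measurable_chain_tauHatGrad W hf c N s
  have hLLG : ∀ s t : Fin (W + 1), Measurable fun x : ℕ → S =>
      tauHatGrad W (toLp 2 fun u : Fin (W + 1) =>
          acovHat (fun (i : ℕ) (x : ℕ → S) => f (x i) - c) N u x) s
        * tauHatGrad W (toLp 2 fun u : Fin (W + 1) =>
          acovHat (fun (i : ℕ) (x : ℕ → S) => f (x i) - c) N u x) t
        * gammaCross (fun i => (f (x i) - c) * (f (x (i + s)) - c))
            (fun i => (f (x i) - c) * (f (x (i + t)) - c)) N K := fun s t =>
    ((hL s).mul (hL t)).mul (hG s t)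
  exact Finset.measurable_sum _ fun s _ => Finset.measurable_sum _ fun t _ => hLLG s t

/-- **The plug-in scale converges in probability**: for `σ²_ℓ > 0`,
`(√σ̂²_N)⁻¹ → (√σ²_ℓ)⁻¹` in `P_{μ₀}`-measure, from every initial law. -/
theorem chain_invSqrt_tauIntVarHat_tendstoInMeasure_of_nHit (hπ : Kernel.Invariant κ π) (hε : ε ≠ 0)
    (hmin : ∀ z, ε • ν ≤ nHit κ m z) (hm : 0 < m)
    {f : S → ℝ} (hf : Measurable f) {C : ℝ} (hC : ∀ z, |f z| ≤ C)
    (hσ : autocov κ π (fun z => f z - ∫ z', f z' ∂π) 0 ≠ 0)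
    (hpos : 0 < ∑ s : Fin (W + 1), ∑ t : Fin (W + 1),
        tauHatGrad W (toLp 2 fun u : Fin (W + 1) => autocov κ π (fun z => f z - ∫ z', f z' ∂π) u) s
          * tauHatGrad W (toLp 2 fun u : Fin (W + 1) => autocov κ π (fun z => f z - ∫ z', f z' ∂π) u) t
          * chainLagACov κ π (fun z => f z - ∫ z', f z' ∂π) W s t)
    {K : ℕ → ℕ} (hK : Tendsto K atTop atTop) (hK3 : Tendsto (fun N => (K N : ℝ) ^ 3 / N) atTop (𝓝 0))
    (μ₀ : Measure S) [IsProbabilityMeasure μ₀] :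
    TendstoInMeasure (Kernel.trajMeasure (X := fun _ : ℕ => S) μ₀
        (fun n : ℕ => κ.comap (fun hh : (i : ↥(Finset.Iic n)) → S => hh ⟨n, Finset.mem_Iic.2 le_rfl⟩)
          (measurable_pi_apply _)))
      (fun (N : ℕ) (x : ℕ → S) => (Real.sqrt (∑ s : Fin (W + 1), ∑ t : Fin (W + 1),
        tauHatGrad W (toLp 2 fun u : Fin (W + 1) =>
            acovHat (fun (i : ℕ) (x : ℕ → S) => f (x i) - ∫ z', f z' ∂π) N u x) s
          * tauHatGrad W (toLp 2 fun u : Fin (W + 1) =>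
            acovHat (fun (i : ℕ) (x : ℕ → S) => f (x i) - ∫ z', f z' ∂π) N u x) t
          * gammaCross (fun i => (f (x i) - ∫ z', f z' ∂π) * (f (x (i + s)) - ∫ z', f z' ∂π))
              (fun i => (f (x i) - ∫ z', f z' ∂π) * (f (x (i + t)) - ∫ z', f z' ∂π)) N (K N)))⁻¹)
      atTop (fun _ => (Real.sqrt (∑ s : Fin (W + 1), ∑ t : Fin (W + 1),
        tauHatGrad W (toLp 2 fun u : Fin (W + 1) => autocov κ π (fun z => f z - ∫ z', f z' ∂π) u) s
          * tauHatGrad W (toLp 2 fun u : Fin (W + 1) => autocov κ π (fun z => f z - ∫ z', f z' ∂π) u) t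
          * chainLagACov κ π (fun z => f z - ∫ z', f z' ∂π) W s t))⁻¹) := by
  have hcons := chain_tauIntVarHat_tendstoInMeasure_of_nHit κ W hπ hε hmin hm hf hC hσ hK hK3 μ₀
  have hsq : ContinuousAt (fun v : ℝ => (Real.sqrt v)⁻¹) (∑ s : Fin (W + 1), ∑ t : Fin (W + 1),
      tauHatGrad W (toLp 2 fun u : Fin (W + 1) => autocov κ π (fun z => f z - ∫ z', f z' ∂π) u) s
        * tauHatGrad W (toLp 2 fun u : Fin (W + 1) => autocov κ π (fun z => f z - ∫ z', f z' ∂π) u) t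
        * chainLagACov κ π (fun z => f z - ∫ z', f z' ∂π) W s t) :=
    Real.continuous_sqrt.continuousAt.inv₀ (Real.sqrt_pos.2 hpos).ne'
  exact tendstoInMeasure_comp_continuousAt (g := fun v : ℝ => (Real.sqrt v)⁻¹) hcons hsq
    (fun N => (measurable_chain_tauIntVarHat W hf _ N (K N)).sqrt.inv)

/-- **THE STUDENTISED CENTRAL LIMIT THEOREM FOR THE WINDOWED `τ_int` ESTIMATOR ON MARKOV-CHAIN DATA,
WITH THE DATA-DRIVEN VARIANCE, FROM EVERY INITIAL LAW.**  `κ` Markov with invariant probability `π`,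
`(nHit κ m)(z, ·) ≥ ε ν` for all `z` (`ε ≠ 0`, `0 < m`); `|f| ≤ C` measurable, `f̄ = f − ∫ f dπ`,
`C(0) ≠ 0`, `σ²_ℓ > 0`; truncations `K_N → ∞`, `K_N³/N → 0`.  Then for EVERY initial law `μ₀`, under
`P_{μ₀}`:  `√N (τ̂_W − τ_W) · (√σ̂²_N)⁻¹ ⇒ N(0, 1)` (the canonical variable `id` on
`(ℝ, gaussianReal 0 1)`). -/
theorem tendstoInDistribution_chain_studentized_tauIntWindow_of_nHit (hπ : Kernel.Invariant κ π)
    (hε : ε ≠ 0) (hmin : ∀ z, ε • ν ≤ nHit κ m z) (hm : 0 < m)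
    {f : S → ℝ} (hf : Measurable f) {C : ℝ} (hC : ∀ z, |f z| ≤ C)
    (hσ : autocov κ π (fun z => f z - ∫ z', f z' ∂π) 0 ≠ 0)
    (hpos : 0 < ∑ s : Fin (W + 1), ∑ t : Fin (W + 1),
        tauHatGrad W (toLp 2 fun u : Fin (W + 1) => autocov κ π (fun z => f z - ∫ z', f z' ∂π) u) s
          * tauHatGrad W (toLp 2 fun u : Fin (W + 1) => autocov κ π (fun z => f z - ∫ z', f z' ∂π) u) t
          * chainLagACov κ π (fun z => f z - ∫ z', f z' ∂π) W s t)
    {K : ℕ → ℕ} (hK : Tendsto K atTop atTop) (hK3 : Tendsto (fun N => (K N : ℝ) ^ 3 / N) atTop (𝓝 0))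
    (μ₀ : Measure S) [IsProbabilityMeasure μ₀]
    [IsProbabilityMeasure (Kernel.trajMeasure (X := fun _ : ℕ => S) μ₀
        (fun n : ℕ => κ.comap (fun hh : (i : ↥(Finset.Iic n)) → S => hh ⟨n, Finset.mem_Iic.2 le_rfl⟩)
          (measurable_pi_apply _)))] :
    TendstoInDistribution (fun (N : ℕ) (x : ℕ → S) =>
        Real.sqrt N
          * (tauIntWindow (fun t => acovHat (fun (i : ℕ) (x : ℕ → S) => f (x i) - ∫ z', f z' ∂π) N t x
                / acovHat (fun (i : ℕ) (x : ℕ → S) => f (x i) - ∫ z', f z' ∂π) N 0 x) W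
            - tauIntWindow (fun t => autocov κ π (fun z => f z - ∫ z', f z' ∂π) t
                / autocov κ π (fun z => f z - ∫ z', f z' ∂π) 0) W)
          * (Real.sqrt (∑ s : Fin (W + 1), ∑ t : Fin (W + 1),
            tauHatGrad W (toLp 2 fun u : Fin (W + 1) =>
                acovHat (fun (i : ℕ) (x : ℕ → S) => f (x i) - ∫ z', f z' ∂π) N u x) s
              * tauHatGrad W (toLp 2 fun u : Fin (W + 1) =>
                acovHat (fun (i : ℕ) (x : ℕ → S) => f (x i) - ∫ z', f z' ∂π) N u x) t
              * gammaCross (fun i => (f (x i) - ∫ z', f z' ∂π) * (f (x (i + s)) - ∫ z', f z' ∂π))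
                  (fun i => (f (x i) - ∫ z', f z' ∂π) * (f (x (i + t)) - ∫ z', f z' ∂π)) N (K N)))⁻¹)
      atTop id (fun _ => Kernel.trajMeasure (X := fun _ : ℕ => S) μ₀
        (fun n : ℕ => κ.comap (fun hh : (i : ↥(Finset.Iic n)) → S => hh ⟨n, Finset.mem_Iic.2 le_rfl⟩)
          (measurable_pi_apply _))) (gaussianReal 0 1) := by
  obtain ⟨hgm, hgC, -⟩ := centred_observable_bounds π hf hC
  set σ2 := ∑ s : Fin (W + 1), ∑ t : Fin (W + 1),
      tauHatGrad W (toLp 2 fun u : Fin (W + 1) => autocov κ π (fun z => f z - ∫ z', f z' ∂π) u) s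
        * tauHatGrad W (toLp 2 fun u : Fin (W + 1) => autocov κ π (fun z => f z - ∫ z', f z' ∂π) u) t
        * chainLagACov κ π (fun z => f z - ∫ z', f z' ∂π) W s t with hσ2
  -- GEN-9's fixed-window law with the concrete limit `Z ∼ N(0, Σ)`, and the law of `⟪ℓ, Z⟫`
  have hclt := tendstoInDistribution_chain_tauIntWindow_multivariateGaussian κ W hπ hε hmin hm hf hC hσ μ₀
  have hY := hasLaw_chain_tauIntWindow_limit_quadForm κ W hπ hε hmin hm hgm hgC
    (toLp 2 fun t : Fin (W + 1) => autocov κ π (fun z => f z - ∫ z', f z' ∂π) t)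
  rw [← hσ2] at hY
  -- the plug-in scale
  have hB := chain_invSqrt_tauIntVarHat_tendstoInMeasure_of_nHit κ W hπ hε hmin hm hf hC hσ hpos hK hK3 μ₀
  have hBm := fun N => (measurable_chain_tauIntVarHat W hf (∫ z', f z' ∂π) N (K N)).sqrt.inv
  have hXB := hclt.continuous_comp_prodMk_of_tendstoInMeasure_const
    (g := fun p : ℝ × ℝ => p.1 * p.2) (by fun_prop) hB (fun N => (hBm N).aemeasurable)
  -- identify the limit law `⟪ℓ, Z⟫ · (√σ²)⁻¹ ∼ N(0, 1)`
  have hb2 : NNReal.mk (((Real.sqrt σ2)⁻¹) ^ 2) (sq_nonneg _) * σ2.toNNReal = 1 := by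
    apply NNReal.eq
    rw [NNReal.coe_mul, NNReal.coe_mk, Real.coe_toNNReal _ hpos.le, NNReal.coe_one, inv_pow,
      Real.sq_sqrt hpos.le, inv_mul_cancel₀ hpos.ne']
  have hlaw : HasLaw (fun z : EuclideanSpace ℝ (Fin (W + 1)) =>
      ⟪tauHatGrad W (toLp 2 fun t : Fin (W + 1) => autocov κ π (fun z => f z - ∫ z', f z' ∂π) t), z⟫
        * (Real.sqrt σ2)⁻¹) (gaussianReal 0 1)
      (multivariateGaussian 0 (Matrix.of fun s t : Fin (W + 1) =>
        chainLagACov κ π (fun z => f z - ∫ z', f z' ∂π) W s t)) := by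
    have h := gaussianReal_mul_const hY (Real.sqrt σ2)⁻¹
    rwa [mul_zero, hb2] at h
  refine ⟨hXB.forall_aemeasurable, aemeasurable_id, ?_⟩
  have ht := hXB.tendsto
  have heq : (⟨(gaussianReal 0 1).map id, Measure.isProbabilityMeasure_map aemeasurable_id⟩ :
      ProbabilityMeasure ℝ)
      = ⟨(multivariateGaussian 0 (Matrix.of fun s t : Fin (W + 1) =>
          chainLagACov κ π (fun z => f z - ∫ z', f z' ∂π) W s t)).map
          (fun z : EuclideanSpace ℝ (Fin (W + 1)) =>
            ⟪tauHatGrad W (toLp 2 fun t : Fin (W + 1) => autocov κ π (fun z => f z - ∫ z', f z' ∂π) t), z⟫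
              * (Real.sqrt σ2)⁻¹),
        Measure.isProbabilityMeasure_map hXB.aemeasurable_limit⟩ := by
    apply Subtype.ext
    show (gaussianReal 0 1).map id = (multivariateGaussian 0 (Matrix.of fun s t : Fin (W + 1) =>
        chainLagACov κ π (fun z => f z - ∫ z', f z' ∂π) W s t)).map
      (fun z : EuclideanSpace ℝ (Fin (W + 1)) =>
        ⟪tauHatGrad W (toLp 2 fun t : Fin (W + 1) => autocov κ π (fun z => f z - ∫ z', f z' ∂π) t), z⟫
          * (Real.sqrt σ2)⁻¹)
    rw [Measure.map_id, hlaw.map_eq]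
  rw [heq]
  exact ht

/-- **THE STUDENTISED ERROR BAR OF `τ̂_W` HAS ASYMPTOTICALLY EXACT COVERAGE ON CHAIN DATA, FROM EVERY
INITIAL LAW.**  Under the hypotheses of `tendstoInDistribution_chain_studentized_tauIntWindow_of_nHit`,
for every `z > 0`:
`P_{μ₀}{|√N (τ̂_W − τ_W) · (√σ̂²_N)⁻¹| ≤ z} → gaussianReal 0 1 (Icc (−z) z)` — the interval
`τ̂_W ± z σ̂_N/√N` covers `τ_W` with probability tending to the nominal Gaussian level. -/
theorem tendsto_measure_chain_studentized_tauIntWindow_le_of_nHit (hπ : Kernel.Invariant κ π)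
    (hε : ε ≠ 0) (hmin : ∀ z, ε • ν ≤ nHit κ m z) (hm : 0 < m)
    {f : S → ℝ} (hf : Measurable f) {C : ℝ} (hC : ∀ z, |f z| ≤ C)
    (hσ : autocov κ π (fun z => f z - ∫ z', f z' ∂π) 0 ≠ 0)
    (hpos : 0 < ∑ s : Fin (W + 1), ∑ t : Fin (W + 1),
        tauHatGrad W (toLp 2 fun u : Fin (W + 1) => autocov κ π (fun z => f z - ∫ z', f z' ∂π) u) s
          * tauHatGrad W (toLp 2 fun u : Fin (W + 1) => autocov κ π (fun z => f z - ∫ z', f z' ∂π) u) t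
          * chainLagACov κ π (fun z => f z - ∫ z', f z' ∂π) W s t)
    {K : ℕ → ℕ} (hK : Tendsto K atTop atTop) (hK3 : Tendsto (fun N => (K N : ℝ) ^ 3 / N) atTop (𝓝 0))
    (μ₀ : Measure S) [IsProbabilityMeasure μ₀] {z : ℝ} (hz : 0 < z)
    [IsProbabilityMeasure (Kernel.trajMeasure (X := fun _ : ℕ => S) μ₀
        (fun n : ℕ => κ.comap (fun hh : (i : ↥(Finset.Iic n)) → S => hh ⟨n, Finset.mem_Iic.2 le_rfl⟩)
          (measurable_pi_apply _)))] :
    Tendsto (fun N : ℕ => (Kernel.trajMeasure (X := fun _ : ℕ => S) μ₀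
        (fun n : ℕ => κ.comap (fun hh : (i : ↥(Finset.Iic n)) → S => hh ⟨n, Finset.mem_Iic.2 le_rfl⟩)
          (measurable_pi_apply _)))
        {x : ℕ → S | |Real.sqrt N
          * (tauIntWindow (fun t => acovHat (fun (i : ℕ) (x : ℕ → S) => f (x i) - ∫ z', f z' ∂π) N t x
                / acovHat (fun (i : ℕ) (x : ℕ → S) => f (x i) - ∫ z', f z' ∂π) N 0 x) W
            - tauIntWindow (fun t => autocov κ π (fun z => f z - ∫ z', f z' ∂π) t
                / autocov κ π (fun z => f z - ∫ z', f z' ∂π) 0) W)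
          * (Real.sqrt (∑ s : Fin (W + 1), ∑ t : Fin (W + 1),
            tauHatGrad W (toLp 2 fun u : Fin (W + 1) =>
                acovHat (fun (i : ℕ) (x : ℕ → S) => f (x i) - ∫ z', f z' ∂π) N u x) s
              * tauHatGrad W (toLp 2 fun u : Fin (W + 1) =>
                acovHat (fun (i : ℕ) (x : ℕ → S) => f (x i) - ∫ z', f z' ∂π) N u x) t
              * gammaCross (fun i => (f (x i) - ∫ z', f z' ∂π) * (f (x (i + s)) - ∫ z', f z' ∂π))
                  (fun i => (f (x i) - ∫ z', f z' ∂π) * (f (x (i + t)) - ∫ z', f z' ∂π)) N (K N)))⁻¹| ≤ z})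
      atTop (𝓝 (gaussianReal 0 1 (Icc (-z) z))) := by
  obtain ⟨hgm, hgC, -⟩ := centred_observable_bounds π hf hC
  set σ2 := ∑ s : Fin (W + 1), ∑ t : Fin (W + 1),
      tauHatGrad W (toLp 2 fun u : Fin (W + 1) => autocov κ π (fun z => f z - ∫ z', f z' ∂π) u) s
        * tauHatGrad W (toLp 2 fun u : Fin (W + 1) => autocov κ π (fun z => f z - ∫ z', f z' ∂π) u) t
        * chainLagACov κ π (fun z => f z - ∫ z', f z' ∂π) W s t with hσ2
  have hclt := tendstoInDistribution_chain_tauIntWindow_multivariateGaussian κ W hπ hε hmin hm hf hC hσ μ₀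
  have hY := hasLaw_chain_tauIntWindow_limit_quadForm κ W hπ hε hmin hm hgm hgC
    (toLp 2 fun t : Fin (W + 1) => autocov κ π (fun z => f z - ∫ z', f z' ∂π) t)
  rw [← hσ2] at hY
  have hB := chain_invSqrt_tauIntVarHat_tendstoInMeasure_of_nHit κ W hπ hε hmin hm hf hC hσ hpos hK hK3 μ₀
  have hBm := fun N => (measurable_chain_tauIntVarHat W hf (∫ z', f z' ∂π) N (K N)).sqrt.inv
  have h := tendsto_measure_abs_mul_le_of_clt_of_tendstoInMeasure hBm hY hclt hB hz
  have hb2 : NNReal.mk (((Real.sqrt σ2)⁻¹) ^ 2) (sq_nonneg _) * σ2.toNNReal = 1 := by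
    apply NNReal.eq
    rw [NNReal.coe_mul, NNReal.coe_mk, Real.coe_toNNReal _ hpos.le, NNReal.coe_one, inv_pow,
      Real.sq_sqrt hpos.le, inv_mul_cancel₀ hpos.ne']
  rw [hb2] at h
  exact h

/-- **One-step minorisation** (`κ(z, ·) ≥ ε ν`, the certificate shape of rows 8 / 9's samplers): the
same exact asymptotic coverage of the studentised `τ̂_W` bar, `m = 1`. -/
theorem tendsto_measure_chain_studentized_tauIntWindow_le_of_minorised (hπ : Kernel.Invariant κ π)
    (hε : ε ≠ 0) (hmin : ∀ z, ε • ν ≤ κ z)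
    {f : S → ℝ} (hf : Measurable f) {C : ℝ} (hC : ∀ z, |f z| ≤ C)
    (hσ : autocov κ π (fun z => f z - ∫ z', f z' ∂π) 0 ≠ 0)
    (hpos : 0 < ∑ s : Fin (W + 1), ∑ t : Fin (W + 1),
        tauHatGrad W (toLp 2 fun u : Fin (W + 1) => autocov κ π (fun z => f z - ∫ z', f z' ∂π) u) s
          * tauHatGrad W (toLp 2 fun u : Fin (W + 1) => autocov κ π (fun z => f z - ∫ z', f z' ∂π) u) t
          * chainLagACov κ π (fun z => f z - ∫ z', f z' ∂π) W s t)
    {K : ℕ → ℕ} (hK : Tendsto K atTop atTop) (hK3 : Tendsto (fun N => (K N : ℝ) ^ 3 / N) atTop (𝓝 0))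
    (μ₀ : Measure S) [IsProbabilityMeasure μ₀] {z : ℝ} (hz : 0 < z)
    [IsProbabilityMeasure (Kernel.trajMeasure (X := fun _ : ℕ => S) μ₀
        (fun n : ℕ => κ.comap (fun hh : (i : ↥(Finset.Iic n)) → S => hh ⟨n, Finset.mem_Iic.2 le_rfl⟩)
          (measurable_pi_apply _)))] :
    Tendsto (fun N : ℕ => (Kernel.trajMeasure (X := fun _ : ℕ => S) μ₀
        (fun n : ℕ => κ.comap (fun hh : (i : ↥(Finset.Iic n)) → S => hh ⟨n, Finset.mem_Iic.2 le_rfl⟩)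
          (measurable_pi_apply _)))
        {x : ℕ → S | |Real.sqrt N
          * (tauIntWindow (fun t => acovHat (fun (i : ℕ) (x : ℕ → S) => f (x i) - ∫ z', f z' ∂π) N t x
                / acovHat (fun (i : ℕ) (x : ℕ → S) => f (x i) - ∫ z', f z' ∂π) N 0 x) W
            - tauIntWindow (fun t => autocov κ π (fun z => f z - ∫ z', f z' ∂π) t
                / autocov κ π (fun z => f z - ∫ z', f z' ∂π) 0) W)
          * (Real.sqrt (∑ s : Fin (W + 1), ∑ t : Fin (W + 1),
            tauHatGrad W (toLp 2 fun u : Fin (W + 1) =>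
                acovHat (fun (i : ℕ) (x : ℕ → S) => f (x i) - ∫ z', f z' ∂π) N u x) s
              * tauHatGrad W (toLp 2 fun u : Fin (W + 1) =>
                acovHat (fun (i : ℕ) (x : ℕ → S) => f (x i) - ∫ z', f z' ∂π) N u x) t
              * gammaCross (fun i => (f (x i) - ∫ z', f z' ∂π) * (f (x (i + s)) - ∫ z', f z' ∂π))
                  (fun i => (f (x i) - ∫ z', f z' ∂π) * (f (x (i + t)) - ∫ z', f z' ∂π)) N (K N)))⁻¹| ≤ z})
      atTop (𝓝 (gaussianReal 0 1 (Icc (-z) z))) := by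
  have hmin' : ∀ z, ε • ν ≤ nHit κ 1 z := fun z => by rw [nHit_one]; exact hmin z
  exact tendsto_measure_chain_studentized_tauIntWindow_le_of_nHit κ W hπ hε hmin' Nat.one_pos hf hC hσ
    hpos hK hK3 μ₀ hz

end Chain

end Summit.Ventures.LatticeQCDFlow.Scoring

end
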